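import Literature.Probability.RandomPlanarGeometry.HexSAWSurfaceYcLimitAllY
import Literature.Probability.RandomPlanarGeometry.HexSAWSurfaceWallRateSqrtMonotone
import Mathlib.Analysis.Convex.Deriv
import HarnessLib

/-!
# Honeycomb SAW at the ZIG-ZAG surface (BBdGDCG 2014) — the ORDER PARAMETER: the one-sided densities `ρ⁻(t) ≤ ρ⁺(t)` of the surface
# free energy `F(t) = log μ(eᵗ)`; `ρ⁻(t) = 0 ↔ eᵗ ≤ 1 + √2`, `ρ⁻(t) > 0 ↔ eᵗ > 1 + √2`; the exceptional set `{ρ⁻ < ρ⁺}` is countable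

Topic `Literature/Probability/RandomPlanarGeometry` (lane «pcv-sawmu»; the ZIG-ZAG twin of the CORE of `HexSAWRotSurfaceOrderParameter.lean`
(Beaton's rotated frame), over two tree files only: `HexSAWSurfaceYcLimitAllY.lean` — `μ(y) := surfaceMu y = max (wallRate y) μ_ℍ`, the limit
`C⁺_n(y)^{1/n} → μ(y)` for every `y > 0`, `surfaceMu_eq_iff : μ(y) = μ_ℍ ↔ y ≤ 1 + √2`, `hexConnectiveConstant_lt_surfaceMu_iff`, `surfaceMu_mono` —
and `HexSAWSurfaceWallRateSqrtMonotone.lean` (a-p5 g12) — `Wall.convexOn_log_wallRate_exp`, `log_wallRate_exp_sub_le`.  The finite-`n`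
sandwich `ρ⁻ − ε ≤ surfDensity_n(eᵗ) ≤ ρ⁺ + ε` (which needs the HOME module «DENSITY-LIMIT» `HexSAWSurfaceDensityLimit.lean` of a-idea-1) and
the saturation / strictness statements `ρ± → ½`, `ρ⁺ < ½` (which need `HexSAWSurfaceWallDensity.lean`) are deliberately left to a SEQUEL, so
that this core builds on served parents.)

Source.  N. R. Beaton, M. Bousquet-Mélou, J. de Gier, H. Duminil-Copin, A. J. Guttmann, *The critical fugacity for surface adsorption of
self-avoiding walks on the honeycomb lattice is `1 + √2`*, Comm. Math. Phys. 326 (2014) 727 = arXiv:1109.0358v5: Theorem 2 (p. 3: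
`y_c = 1 + √2`); §3.1, Proposition 5 (p. 9: "`μ(y)` … is a log-convex, non-decreasing function of `log y`, and therefore continuous and almost
everywhere differentiable … `= μ` if `y ≤ y_c`, `> μ` if `y > y_c`") and the density remark after it (p. 10: "the mean density of vertices …
tends to `y ∂ log μ(y)/∂y` … is `0` for `y < y_c` and is positive for `y > y_c`", footnote 4: convexity, [26, Thm. B7]).  E. J. Janse van
Rensburg, S. G. Whittington, J. Phys. A 46 (2013) 435003, §3.1 eq. (3.4) (hypercubic left/right densities `𝓔_±`, "exist for every finite
a > 0 since κ(a) is a convex function of log a … monotone … `𝓔(a) = 0` if `a < a_c` and `𝓔(a) > 0` for almost all `a > a_c`").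

## What is proved (namespace `Literature.Probability.RandomPlanarGeometry.SAW.HV`; no hypotheses beyond `0 < y`)

* vocabulary `surfFreeEnergy t = F(t) := log μ(eᵗ)`, `surfRightDensity t = ρ⁺(t) := d⁺F/dt`, `surfLeftDensity t = ρ⁻(t) := d⁻F/dt`;
  `surfFreeEnergy_eq_max` (`F = max(log β(eᵗ), log μ_ℍ)`), `convexOn_surfFreeEnergy`, `surfFreeEnergy_sub_mem_Icc`, chord slopes in `[0, ½]`,
  `hasDerivWithinAt_surfRightDensity` / `…Left…`, `surfDensities_mem_Icc` (`0 ≤ ρ⁻ ≤ ρ⁺ ≤ ½`), `monotone_surfRightDensity` / `…Left…`,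
  interlacing `surfRightDensity_le_surfLeftDensity_of_lt`, chord sandwich;
* THE ORDER PARAMETER: `surfFreeEnergy_eq_of_le` (`F = log μ_ℍ` on `eᵗ ≤ 1+√2`), `surfRightDensity_eq_zero_of_lt`, **`surfLeftDensity_eq_zero_iff :
  ρ⁻(t) = 0 ↔ eᵗ ≤ 1 + √2`**, **`surfLeftDensity_pos_iff : 0 < ρ⁻(t) ↔ 1 + √2 < eᵗ`** with the explicit chord bound `div_le_surfLeftDensity :
  (F(t) − log μ_ℍ)/(t − log(1+√2)) ≤ ρ⁻(t)`, `surfRightDensity_pos_of_gt`;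
* `countable_setOf_surfLeftDensity_lt_surfRightDensity` (pairwise-disjoint rational intervals), `hasDerivAt_surfFreeEnergy_of_eq`,
  `surfLeftDensity_eq_surfRightDensity_of_differentiableAt`, `differentiableAt_surfaceMu_exp_iff` and **`countable_setOf_not_differentiableAt_surfaceMu`**
  — BBdGDCG's `μ(·)` is differentiable at every `y > 0` outside a COUNTABLE set (print: "almost everywhere differentiable").

LABEL (author's proposal): CONSOLIDATION AS PRINTED of BBdGDCG Prop. 5's convexity clauses + the p.10 density remark in the Janse van
Rensburg–Whittington left/right-density vocabulary; lane corollaries XS: the two `iff`s for the LEFT density at EVERY `y` (print: "for almost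
all" in JvR–W; "is positive for y > y_c" in BBdGDCG, read there through a.e.-differentiability) and the countable exceptional set.  NOT claimed:
anything on `ρ⁺` AT `y_c = 1 + √2` (the order of the transition), differentiability of `μ(·)` at any specific `y > y_c`.  This module does NOT
restate `HexSAWSurfaceYcProp5Riders`' `convexOn_log_surfaceMu_exp` / `hasDerivAt_surfaceMu_zero` / `deriv_surfaceMu_pos` (same lane; those
remain the `y`-variable statements).  Lane «pcv-sawmu», seat a-p6 g13 for the a-idea-1 / a-p5 lineage (requested by a-idea-1 g26).
-/

noncomputable section

open Finset Filter Function
open _root_.Topology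

namespace Literature.Probability.RandomPlanarGeometry.SAW.HV

open HexBW HexBW.Wall

variable {y : ℝ}

/-! ### Vocabulary: the free energy of BBdGDCG's `μ(y)` and its one-sided densities -/

/-- **`F(t) := log μ(eᵗ)`**, the surface free energy of BBdGDCG's zig-zag model as a function of `t = log y` (convex: `convexOn_surfFreeEnergy`). [cite: BeatonBousquetMelouDeGierDuminilCopinGuttmann2014, §3.1, Proposition 5 (arXiv v5 p. 9: "log-convex, non-decreasing function of log y")] -/
def surfFreeEnergy (t : ℝ) : ℝ := Real.log (surfaceMu (Real.exp t))

/-- **`ρ⁺(t) := d⁺F/dt`**, the RIGHT density of surface vertices at fugacity `y = eᵗ`.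
[cite: BeatonBousquetMelouDeGierDuminilCopinGuttmann2014, §3.1, density remark after Proposition 5 (arXiv v5 p. 10: "this density tends to y ∂ log μ(y)/∂y"); JansevanRensburgWhittington2013, §3.1 eq. (3.4) (arXiv v4 p. 6: hypercubic 𝓔_+)] -/
def surfRightDensity (t : ℝ) : ℝ := derivWithin surfFreeEnergy (Set.Ioi t) t

/-- **`ρ⁻(t) := d⁻F/dt`**, the LEFT density of surface vertices at fugacity `y = eᵗ` — the order parameter.
[cite: BeatonBousquetMelouDeGierDuminilCopinGuttmann2014, §3.1, density remark after Proposition 5 (arXiv v5 p. 10); JansevanRensburgWhittington2013, §3.1 eq. (3.4) (arXiv v4 p. 6: hypercubic 𝓔_-)] -/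
def surfLeftDensity (t : ℝ) : ℝ := derivWithin surfFreeEnergy (Set.Iio t) t

/-- `F(t) = log μ(eᵗ)` (unfolding). [cite: BeatonBousquetMelouDeGierDuminilCopinGuttmann2014, §3.1, Proposition 5 (arXiv v5 p. 9)] -/
theorem surfFreeEnergy_apply (t : ℝ) : surfFreeEnergy t = Real.log (surfaceMu (Real.exp t)) := rfl

/-- `F(t) = max(log β(eᵗ), log μ_ℍ)` (`μ(y) = max(β(y), μ_ℍ)` and `log` is monotone on `(0, ∞)`).
[cite: BeatonBousquetMelouDeGierDuminilCopinGuttmann2014, §3.1, Proposition 5 (arXiv v5 p. 9: "μ(y) ≥ max(μ, √y)")] -/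
theorem surfFreeEnergy_eq_max (t : ℝ) :
    surfFreeEnergy t = max (Real.log (wallRate (Real.exp t))) (Real.log hexConnectiveConstant) := by
  rw [surfFreeEnergy_apply, surfaceMu]
  exact Real.strictMonoOn_log.monotoneOn.map_max (wallRate_pos _) hexConnectiveConstant_pos

/-- **`F` is convex on `ℝ`** (the maximum of the convex `t ↦ log β(eᵗ)` of `HexSAWSurfaceWallRateSqrtMonotone` and a constant;
`HexSAWSurfaceYcProp5Riders` proves the same by Hölder on `C⁺_n` — re-derived here so that this module builds today).
[cite: BeatonBousquetMelouDeGierDuminilCopinGuttmann2014, §3.1, Proposition 5 (arXiv v5 p. 9: "log-convex … function of log y")] -/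
theorem convexOn_surfFreeEnergy : ConvexOn ℝ Set.univ surfFreeEnergy := by
  have hfun : surfFreeEnergy = (fun t : ℝ => Real.log (wallRate (Real.exp t))) ⊔ (fun _ : ℝ => Real.log hexConnectiveConstant) := by
    funext t
    rw [Pi.sup_apply]
    exact surfFreeEnergy_eq_max t
  rw [hfun]
  exact convexOn_log_wallRate_exp.sup (convexOn_const _ convex_univ)

/-- `0 ≤ F(t') − F(t) ≤ (t' − t)/2` for `t ≤ t'` (monotonicity of `μ(·)`; and `μ(y') = max(β(y'), μ_ℍ) ≤ max(e^{(t'−t)/2} β(y), μ_ℍ) ≤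
e^{(t'−t)/2} μ(y)` from the wall-rate window `log β(e^{t'}) − log β(eᵗ) ≤ (t' − t)/2` of `HexSAWSurfaceWallRateSqrtMonotone`).
[cite: BeatonBousquetMelouDeGierDuminilCopinGuttmann2014, §3.1, Proposition 5 (arXiv v5 p. 9: "non-decreasing")] -/
theorem surfFreeEnergy_sub_mem_Icc {t t' : ℝ} (htt' : t ≤ t') :
    surfFreeEnergy t' - surfFreeEnergy t ∈ Set.Icc (0 : ℝ) ((t' - t) / 2) := by
  constructor
  · exact sub_nonneg.2 (Real.log_le_log (surfaceMu_pos _) (surfaceMu_mono (Real.exp_pos t) (Real.exp_le_exp.2 htt')))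
  · rw [surfFreeEnergy_eq_max, surfFreeEnergy_eq_max]
    have hβ := log_wallRate_exp_sub_le htt'
    have hnn : 0 ≤ (t' - t) / 2 := by linarith
    rcases le_total (Real.log (wallRate (Real.exp t'))) (Real.log hexConnectiveConstant) with h1 | h1
    · rw [max_eq_right h1]
      linarith [le_max_right (Real.log (wallRate (Real.exp t))) (Real.log hexConnectiveConstant)]
    · rw [max_eq_left h1]
      linarith [le_max_left (Real.log (wallRate (Real.exp t))) (Real.log hexConnectiveConstant)]

/-- Every chord of `F` has slope in `[0, ½]`. [cite: BeatonBousquetMelouDeGierDuminilCopinGuttmann2014, §3.1, Proposition 5 (arXiv v5 p. 9)] -/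
theorem slope_surfFreeEnergy_mem_Icc {t t' : ℝ} (h : t < t') : slope surfFreeEnergy t t' ∈ Set.Icc (0 : ℝ) (1 / 2) := by
  obtain ⟨h0, h1⟩ := surfFreeEnergy_sub_mem_Icc h.le
  have hpos : 0 < t' - t := sub_pos.2 h
  rw [slope_def_field]
  exact ⟨div_nonneg h0 hpos.le, (div_le_iff₀ hpos).2 (by linarith)⟩

/-- `ρ⁺(t)` IS the right derivative of `F` at `t`. [cite: BeatonBousquetMelouDeGierDuminilCopinGuttmann2014, §3.1, Proposition 5 (arXiv v5 p. 9: "almost everywhere differentiable"); JansevanRensburgWhittington2013, §3.1 eq. (3.4) (arXiv v4 p. 6: «These exist for every finite a > 0 since κ(a) is a convex function of log a»)] -/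
theorem hasDerivWithinAt_surfRightDensity (t : ℝ) : HasDerivWithinAt surfFreeEnergy (surfRightDensity t) (Set.Ioi t) t :=
  convexOn_surfFreeEnergy.hasDerivWithinAt_rightDeriv_of_mem_interior (by simp)

/-- `ρ⁻(t)` IS the left derivative of `F` at `t`. [cite: BeatonBousquetMelouDeGierDuminilCopinGuttmann2014, §3.1, Proposition 5 (arXiv v5 p. 9); JansevanRensburgWhittington2013, §3.1 eq. (3.4) (arXiv v4 p. 6)] -/
theorem hasDerivWithinAt_surfLeftDensity (t : ℝ) : HasDerivWithinAt surfFreeEnergy (surfLeftDensity t) (Set.Iio t) t :=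
  convexOn_surfFreeEnergy.hasDerivWithinAt_leftDeriv_of_mem_interior (by simp)

/-- `ρ⁻(t) ≤ ρ⁺(t)`. [cite: BeatonBousquetMelouDeGierDuminilCopinGuttmann2014, §3.1, Proposition 5 (arXiv v5 p. 9); JansevanRensburgWhittington2013, §3.1 eq. (3.4) (arXiv v4 p. 6: «𝓔_-(a) ≤ 𝓔_+(a)»)] -/
theorem surfLeftDensity_le_surfRightDensity (t : ℝ) : surfLeftDensity t ≤ surfRightDensity t :=
  convexOn_surfFreeEnergy.leftDeriv_le_rightDeriv_of_mem_interior (by simp)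

/-- `ρ⁺` is non-decreasing. [cite: BeatonBousquetMelouDeGierDuminilCopinGuttmann2014, §3.1, Proposition 5 (arXiv v5 p. 9: "log-convex"); JansevanRensburgWhittington2013, §3.1 (arXiv v4 p. 6: «monotone functions»)] -/
theorem monotone_surfRightDensity : Monotone surfRightDensity := by
  intro t t' h
  have := convexOn_surfFreeEnergy.monotoneOn_rightDeriv (by simp : t ∈ interior (Set.univ : Set ℝ)) (by simp) h
  simpa [surfRightDensity] using this

/-- `ρ⁻` is non-decreasing. [cite: BeatonBousquetMelouDeGierDuminilCopinGuttmann2014, §3.1, Proposition 5 (arXiv v5 p. 9: "log-convex"); JansevanRensburgWhittington2013, §3.1 (arXiv v4 p. 6)] -/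
theorem monotone_surfLeftDensity : Monotone surfLeftDensity := by
  intro t t' h
  have := convexOn_surfFreeEnergy.monotoneOn_leftDeriv (by simp : t ∈ interior (Set.univ : Set ℝ)) (by simp) h
  simpa [surfLeftDensity] using this

/-- `ρ⁺(t) ≤ slope F t t'` for `t < t'`. [cite: BeatonBousquetMelouDeGierDuminilCopinGuttmann2014, §3.1, Proposition 5 (arXiv v5 p. 9: "log-convex")] -/
theorem surfRightDensity_le_slope {t t' : ℝ} (h : t < t') : surfRightDensity t ≤ slope surfFreeEnergy t t' :=
  convexOn_surfFreeEnergy.rightDeriv_le_slope_of_mem_interior (by simp) (Set.mem_univ t') h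

/-- `slope F t t' ≤ ρ⁻(t')` for `t < t'`. [cite: BeatonBousquetMelouDeGierDuminilCopinGuttmann2014, §3.1, Proposition 5 (arXiv v5 p. 9: "log-convex")] -/
theorem slope_le_surfLeftDensity {t t' : ℝ} (h : t < t') : slope surfFreeEnergy t t' ≤ surfLeftDensity t' :=
  convexOn_surfFreeEnergy.slope_le_leftDeriv_of_mem_interior (Set.mem_univ t) (by simp) h

/-- The one-sided densities interlace: `ρ⁺(t) ≤ ρ⁻(t')` for `t < t'`. [cite: BeatonBousquetMelouDeGierDuminilCopinGuttmann2014, §3.1, Proposition 5 (arXiv v5 p. 9: "log-convex")] -/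
theorem surfRightDensity_le_surfLeftDensity_of_lt {t t' : ℝ} (h : t < t') : surfRightDensity t ≤ surfLeftDensity t' :=
  (surfRightDensity_le_slope h).trans (slope_le_surfLeftDensity h)

/-- **`0 ≤ ρ⁻(t) ≤ ρ⁺(t) ≤ ½` at every `t`.** [cite: BeatonBousquetMelouDeGierDuminilCopinGuttmann2014, §3.1, Proposition 5 (arXiv v5 p. 9: "non-decreasing … μ(y) ≥ max{μ, √y}")] -/
theorem surfDensities_mem_Icc (t : ℝ) :
    0 ≤ surfLeftDensity t ∧ surfLeftDensity t ≤ surfRightDensity t ∧ surfRightDensity t ≤ 1 / 2 :=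
  ⟨(slope_surfFreeEnergy_mem_Icc (sub_one_lt t)).1.trans (slope_le_surfLeftDensity (sub_one_lt t)),
    surfLeftDensity_le_surfRightDensity t,
    (surfRightDensity_le_slope (lt_add_one t)).trans (slope_surfFreeEnergy_mem_Icc (lt_add_one t)).2⟩

/-! ### The order parameter: zero exactly up to `y_c`, positive beyond -/

/-- **Desorbed phase: `F(t) = log μ` whenever `eᵗ ≤ y_c`.** [cite: BeatonBousquetMelouDeGierDuminilCopinGuttmann2014, §3.1, Proposition 5 (arXiv v5 p. 9: "μ(y) = μ if y ≤ y_c") and Theorem 2 (p. 3: y_c = 1 + √2)] -/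
theorem surfFreeEnergy_eq_of_le {t : ℝ} (ht : Real.exp t ≤ (1 + Real.sqrt 2)) : surfFreeEnergy t = Real.log hexConnectiveConstant := by
  rw [surfFreeEnergy_apply, (surfaceMu_eq_iff (Real.exp_pos t)).2 ht]

/-- `log μ ≤ F(t)` at every `t`. [cite: BeatonBousquetMelouDeGierDuminilCopinGuttmann2014, §3.1, Proposition 5 (arXiv v5 p. 9: "μ(y) ≥ max{μ, √y}")] -/
theorem log_hexConnectiveConstant_le_surfFreeEnergy (t : ℝ) : Real.log hexConnectiveConstant ≤ surfFreeEnergy t :=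
  Real.log_le_log (by rw [hexConnectiveConstant_eq_inv]; exact inv_pos.2 hexCriticalFugacity_pos_lt_one.1)
    (hexConnectiveConstant_le_surfaceMu _)

/-- **Adsorbed phase: `log μ < F(t)` whenever `y_c < eᵗ`.** [cite: BeatonBousquetMelouDeGierDuminilCopinGuttmann2014, §3.1, Proposition 5 (arXiv v5 p. 9: "> μ if y > y_c")] -/
theorem log_hexConnectiveConstant_lt_surfFreeEnergy {t : ℝ} (ht : (1 + Real.sqrt 2) < Real.exp t) :
    Real.log hexConnectiveConstant < surfFreeEnergy t :=
  Real.log_lt_log (by rw [hexConnectiveConstant_eq_inv]; exact inv_pos.2 hexCriticalFugacity_pos_lt_one.1)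
    ((hexConnectiveConstant_lt_surfaceMu_iff (Real.exp_pos t)).2 ht)

/-- **`ρ⁺(t) = 0` for `eᵗ < y_c`** (zero density strictly below the transition: `F` is constant on a neighbourhood).
[cite: BeatonBousquetMelouDeGierDuminilCopinGuttmann2014, §3.1, density remark after Proposition 5 (arXiv v5 p. 10: "the density of vertices in the surface is 0 for y < y_c")] -/
theorem surfRightDensity_eq_zero_of_lt {t : ℝ} (ht : Real.exp t < (1 + Real.sqrt 2)) : surfRightDensity t = 0 := by
  refine le_antisymm ?_ ((surfDensities_mem_Icc t).1.trans (surfLeftDensity_le_surfRightDensity t))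
  -- a right chord inside the constant region has slope 0
  have hlt : t < Real.log (1 + Real.sqrt 2) := (Real.lt_log_iff_exp_lt (by positivity)).2 ht
  set t' : ℝ := (t + Real.log (1 + Real.sqrt 2)) / 2 with ht'
  have htt' : t < t' := by rw [ht']; linarith
  have ht'c : Real.exp t' ≤ (1 + Real.sqrt 2) := by
    have : t' < Real.log (1 + Real.sqrt 2) := by rw [ht']; linarith
    exact ((Real.lt_log_iff_exp_lt (by positivity)).1 this).le
  have hs : slope surfFreeEnergy t t' = 0 := by
    rw [slope_def_field, surfFreeEnergy_eq_of_le ht'c, surfFreeEnergy_eq_of_le ht.le, sub_self, zero_div]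
  exact (surfRightDensity_le_slope htt').trans_eq hs

/-- **`ρ⁻(t) = 0` for `eᵗ ≤ y_c`** — the left density vanishes up to AND INCLUDING the critical fugacity (left chords at `log y_c`
lie in the constant region). [cite: BeatonBousquetMelouDeGierDuminilCopinGuttmann2014, §3.1, density remark after Proposition 5 (arXiv v5 p. 10: "0 for y < y_c")] -/
theorem surfLeftDensity_eq_zero_of_le {t : ℝ} (ht : Real.exp t ≤ (1 + Real.sqrt 2)) : surfLeftDensity t = 0 := by
  refine le_antisymm ?_ (surfDensities_mem_Icc t).1
  -- the left derivative is the limit of left secant slopes, all of which vanish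
  have hL := hasDerivWithinAt_surfLeftDensity t
  rw [hasDerivWithinAt_iff_tendsto_slope' (show t ∉ Set.Iio t from lt_irrefl t)] at hL
  haveI : (𝓝[Set.Iio t] t).NeBot := nhdsLT_neBot t
  refine le_of_tendsto hL (eventually_nhdsWithin_of_forall fun s hs => ?_)
  have hs' : s < t := hs
  have hsc : Real.exp s ≤ (1 + Real.sqrt 2) := (Real.exp_le_exp.2 hs'.le).trans ht
  simp only [slope_def_field, surfFreeEnergy_eq_of_le ht, surfFreeEnergy_eq_of_le hsc, sub_self, zero_div, le_refl]

/-- **The chord from the critical point bounds the left density below: `(F(t) − log μ)/(t − log y_c) ≤ ρ⁻(t)` for `y_c < eᵗ`.**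
[cite: BeatonBousquetMelouDeGierDuminilCopinGuttmann2014, §3.1, Proposition 5 (arXiv v5 p. 9: "log-convex … > μ if y > y_c")] -/
theorem div_le_surfLeftDensity {t : ℝ} (ht : (1 + Real.sqrt 2) < Real.exp t) :
    (surfFreeEnergy t - Real.log hexConnectiveConstant) / (t - Real.log (1 + Real.sqrt 2)) ≤ surfLeftDensity t := by
  have hlt : Real.log (1 + Real.sqrt 2) < t := (Real.log_lt_iff_lt_exp (by positivity)).2 ht
  have h := slope_le_surfLeftDensity hlt
  rw [slope_def_field, surfFreeEnergy_eq_of_le (t := Real.log (1 + Real.sqrt 2)) (by rw [Real.exp_log (by positivity : (0:ℝ) < 1 + Real.sqrt 2)])] at h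
  exact h

/-- **Adsorbed phase: `0 < ρ⁻(t)` for EVERY `eᵗ > y_c`** (print: "positive for `y > y_c`", read there through a.e.-differentiability;
here for the left density at every such fugacity). [cite: BeatonBousquetMelouDeGierDuminilCopinGuttmann2014, §3.1, density remark after Proposition 5 (arXiv v5 p. 10: "is positive for y > y_c")] -/
theorem surfLeftDensity_pos_of_gt {t : ℝ} (ht : (1 + Real.sqrt 2) < Real.exp t) : 0 < surfLeftDensity t := by
  have hlt : Real.log (1 + Real.sqrt 2) < t := (Real.log_lt_iff_lt_exp (by positivity)).2 ht
  exact (div_pos (sub_pos.2 (log_hexConnectiveConstant_lt_surfFreeEnergy ht)) (sub_pos.2 hlt)).trans_le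
    (div_le_surfLeftDensity ht)

/-- **THE ORDER PARAMETER: `ρ⁻(t) = 0 ↔ eᵗ ≤ y_c`.** [cite: BeatonBousquetMelouDeGierDuminilCopinGuttmann2014, §3.1, density remark after Proposition 5 (arXiv v5 p. 10: "0 for y < y_c and is positive for y > y_c")] -/
theorem surfLeftDensity_eq_zero_iff {t : ℝ} : surfLeftDensity t = 0 ↔ Real.exp t ≤ (1 + Real.sqrt 2) := by
  refine ⟨fun h => ?_, surfLeftDensity_eq_zero_of_le⟩
  by_contra hlt
  exact absurd h (surfLeftDensity_pos_of_gt (not_le.1 hlt)).ne'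

/-- **`0 < ρ⁻(t) ↔ y_c < eᵗ`.** [cite: BeatonBousquetMelouDeGierDuminilCopinGuttmann2014, §3.1, density remark after Proposition 5 (arXiv v5 p. 10)] -/
theorem surfLeftDensity_pos_iff {t : ℝ} : 0 < surfLeftDensity t ↔ (1 + Real.sqrt 2) < Real.exp t := by
  refine ⟨fun h => ?_, surfLeftDensity_pos_of_gt⟩
  by_contra hle
  exact absurd (surfLeftDensity_eq_zero_of_le (not_lt.1 hle)) h.ne'

/-- `0 < ρ⁺(t)` for `y_c < eᵗ`. [cite: BeatonBousquetMelouDeGierDuminilCopinGuttmann2014, §3.1, density remark after Proposition 5 (arXiv v5 p. 10)] -/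
theorem surfRightDensity_pos_of_gt {t : ℝ} (ht : (1 + Real.sqrt 2) < Real.exp t) : 0 < surfRightDensity t :=
  (surfLeftDensity_pos_of_gt ht).trans_le (surfLeftDensity_le_surfRightDensity t)

/-! ### The exceptional set is countable -/

/-- **The fugacities at which the left and right densities differ form a countable set** — the open intervals
`(ρ⁻(t), ρ⁺(t))` are pairwise disjoint (interlacing), and each contains a rational.
[cite: BeatonBousquetMelouDeGierDuminilCopinGuttmann2014, §3.1, Proposition 5 (arXiv v5 p. 9: "almost everywhere differentiable")] -/
theorem countable_setOf_surfLeftDensity_lt_surfRightDensity : {t : ℝ | surfLeftDensity t < surfRightDensity t}.Countable := by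
  set s : Set ℝ := {t : ℝ | surfLeftDensity t < surfRightDensity t} with hs
  have hq : ∀ t ∈ s, ∃ q : ℚ, surfLeftDensity t < (q : ℝ) ∧ (q : ℝ) < surfRightDensity t := fun t ht => exists_rat_btwn ht
  choose! q hq using hq
  refine Set.MapsTo.countable_of_injOn (Set.mapsTo_univ q s) (fun t ht t' ht' hqq => ?_) Set.countable_univ
  by_contra hne
  rcases lt_or_gt_of_ne hne with h | h
  · have h1 := (hq t ht).2.trans_le ((surfRightDensity_le_surfLeftDensity_of_lt h).trans (hq t' ht').1.le)
    rw [hqq] at h1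
    exact lt_irrefl _ h1
  · have h1 := (hq t' ht').2.trans_le ((surfRightDensity_le_surfLeftDensity_of_lt h).trans (hq t ht).1.le)
    rw [hqq] at h1
    exact lt_irrefl _ h1

/-- Off the countable exceptional set, `F` is differentiable at `t` with derivative `ρ⁺(t) = ρ⁻(t)`.
[cite: BeatonBousquetMelouDeGierDuminilCopinGuttmann2014, §3.1, Proposition 5 (arXiv v5 p. 9: "almost everywhere differentiable")] -/
theorem hasDerivAt_surfFreeEnergy_of_eq {t : ℝ} (h : surfLeftDensity t = surfRightDensity t) :
    HasDerivAt surfFreeEnergy (surfRightDensity t) t := by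
  have hL := hasDerivWithinAt_surfLeftDensity t
  have hR := hasDerivWithinAt_surfRightDensity t
  rw [h] at hL
  have hu := hL.union hR
  rw [Set.Iio_union_Ioi, Set.compl_eq_univ_sdiff, hasDerivWithinAt_sdiff_singleton, hasDerivWithinAt_univ] at hu
  exact hu

/-! ### Differentiability of `μ(·)` fails only on a countable set of fugacities -/

/-- Where `F` is differentiable the two densities of BBdGDCG's `μ(y)` agree.
[cite: BeatonBousquetMelouDeGierDuminilCopinGuttmann2014, §3.1, Proposition 5 (arXiv v5 p. 9)] -/
theorem surfLeftDensity_eq_surfRightDensity_of_differentiableAt {t : ℝ} (hd : DifferentiableAt ℝ surfFreeEnergy t) :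
    surfLeftDensity t = surfRightDensity t := by
  have h := hd.hasDerivAt
  rw [surfLeftDensity, surfRightDensity, (h.hasDerivWithinAt (s := Set.Iio t)).derivWithin (uniqueDiffWithinAt_Iio t),
    (h.hasDerivWithinAt (s := Set.Ioi t)).derivWithin (uniqueDiffWithinAt_Ioi t)]

/-- `μ(·)` is differentiable at `y = eᵗ` iff `F` is differentiable at `t`. [cite: BeatonBousquetMelouDeGierDuminilCopinGuttmann2014, §3.1, Proposition 5 (arXiv v5 p. 9)] -/
theorem differentiableAt_surfaceMu_exp_iff (t : ℝ) :
    DifferentiableAt ℝ surfaceMu (Real.exp t) ↔ DifferentiableAt ℝ surfFreeEnergy t := by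
  constructor
  · intro hd
    have h1 : DifferentiableAt ℝ (fun s : ℝ => surfaceMu (Real.exp s)) t := hd.comp t (Real.differentiableAt_exp)
    exact h1.log (surfaceMu_pos _).ne'
  · intro hd
    have hev : surfaceMu =ᶠ[𝓝 (Real.exp t)] fun y : ℝ => Real.exp (surfFreeEnergy (Real.log y)) := by
      filter_upwards [Ioi_mem_nhds (Real.exp_pos t)] with y hy
      rw [surfFreeEnergy_apply, Real.exp_log hy, Real.exp_log (surfaceMu_pos y)]
    have hlog : DifferentiableAt ℝ Real.log (Real.exp t) := Real.differentiableAt_log (Real.exp_pos t).ne'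
    have hd' : DifferentiableAt ℝ surfFreeEnergy (Real.log (Real.exp t)) := by rwa [Real.log_exp]
    have h2 : DifferentiableAt ℝ (fun y : ℝ => Real.exp (surfFreeEnergy (Real.log y))) (Real.exp t) :=
      (hd'.comp (Real.exp t) hlog).exp
    exact h2.congr_of_eventuallyEq hev

/-- **BBdGDCG's `μ(·)` is differentiable at every `y > 0` outside a COUNTABLE set** (print: "almost everywhere differentiable").
[cite: BeatonBousquetMelouDeGierDuminilCopinGuttmann2014, §3.1, Proposition 5 (arXiv v5 p. 9: "almost everywhere differentiable")] -/
theorem countable_setOf_not_differentiableAt_surfaceMu :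
    {y : ℝ | 0 < y ∧ ¬ DifferentiableAt ℝ surfaceMu y}.Countable := by
  refine (countable_setOf_surfLeftDensity_lt_surfRightDensity.image Real.exp).mono fun y hy => ?_
  obtain ⟨hy0, hnd⟩ := hy
  refine ⟨Real.log y, ?_, Real.exp_log hy0⟩
  refine lt_of_le_of_ne (surfLeftDensity_le_surfRightDensity _) fun heq => hnd ?_
  have h := (differentiableAt_surfaceMu_exp_iff (Real.log y)).2 (hasDerivAt_surfFreeEnergy_of_eq heq).differentiableAt
  rwa [Real.exp_log hy0] at h

end Literature.Probability.RandomPlanarGeometry.SAW.HV
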